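import Summits.BirchSwinnertonDyer.BirchSwinnertonDyer.Theorems.QuadraticBranchSignedControlPlusEtaNonsurjCartanMatrix
import Summits.BirchSwinnertonDyer.Rank1Residual.GaloisImage.SupersingularExactImage
import Summits.BirchSwinnertonDyer.Rank1Residual.O6.X4CongruenceAnchor
import Literature.NumberTheory.EllipticCurves.BSDSelmerPConverseSerreProofs
import HarnessLib

/-!
# Route `QuadraticBranchSignedControl` (rung K8, cell `bsd-potss`): crux stmt-BirchSwinnertonDyer-19606
# `PlusEtaMainConjectureNonsurj` — THE CARTAN SUBGROUP OF A ROW: intrinsic, index `2`, a mod-`p` INVARIANT;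
# no transvection acts on `V[p]` (part 1 of the kernel form of FINDING-19606-k8eta-c2-g5 §2)

WHAT. The rows of crux 19606 are the `ℚ`-points of `X_ns⁺(p)`: in a basis `e` of `V[p]`, `Γ_ℚ` acts through EXACTLY the
normaliser `C_ns⁺(ε)` of a non-split Cartan subgroup (`not_forall_surj_pow_iff_cartanNormalizer`, p448914). The
inverse image `ρ̄⁻¹(C_ns(ε))` is an index-`2` subgroup of `Γ_ℚ` — the absolute Galois group of the CARTAN FIELD `K_V`
(g5 §2: `K_V = ℚ(√−(8t² − 12t + 7))` on Zywina's `X_ns⁺(5)`; Frengley L. 28 / Halberstadt III.5.18). Every road of the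
cell to a NON-CM row is a transfer along a mod-`p` congruence `V[p] ≅ A[p]` (`ModPCongruent`) from an ANCHOR `A`
(k8eta-c2 g3/g5 unit rows; g8 CM curves + the Corpuz–Lei binder), and the v7 skeleton candidate's hardest stub is
«(C1⁺_η) on the non-CM rows NOT congruent to a CM row». This file (and its companion `…CartanFieldCMAnchor`) proves,
in the kernel and BASIS-FREE:

* §1 frames: the matrix of a product / uniqueness / commutation transfer (`matrix_mul`, `matrix_unique`,
  `smul_comm_iff_matrix_comm`).
* §2 **intrinsic Cartan subgroup.** For `σ ∈ Γ_ℚ` let `C(σ)` := "`σ` commutes on `V[p]` with every SQUARE `τ²`".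
  `matrix_mem_nonsplitCartan_iff_centralizes_sq`: in ANY frame, `ρ̄(σ) ∈ C_ns(ε) ⟺ C(σ)` (squares of `C_ns⁺` lie in the
  commutative `C_ns`; conversely an element of the other coset moves the square `(1 + √ε)²`, `p ≠ 2`). Hence `C` does not
  depend on the frame, `exists_not_centralizes_sq` / `centralizes_sq_mul_of_not_of_not` (index `2`), and
  `exists_subgroup_index_two_centralizes_sq`: **there is a subgroup `H_V ≤ Γ_ℚ` of index `2` with `σ ∈ H_V ⟺ C(σ)`**
  (`= ρ̄⁻¹(C_ns)`, the Cartan subgroup; its fixed field is `K_V`) — an ∃-statement, no new definition.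
* §3 **congruence invariance** `centralizes_sq_iff_of_modPCongruent`: `V[p] ≅ A[p]` `Γ_ℚ`-equivariantly ⟹ `C_V(σ) ⟺ C_A(σ)`
  for every `σ` — `K_V` is an invariant of the mod-`p` Galois module (one line, no frame needed). The companion file adds:
  a CM anchor (a `√D`-structure on `A[p]`) forces `H_V = Γ_K`, i.e. `K_V` = the CM field.
* §4 **no transvection** `smul_eq_self_of_transvection`: on a row, a `σ` with `(σ − 1)² = 0` on `V[p]` acts trivially
  (`C_ns⁺` has no element of order `p`, `eq_one_of_unipotent_of_mem_nonsplitCartanNormalizer`) — the torsion-level reason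
  why Kato's Thm. 13.4 (3) (`T/(σ−1)T ≅ ℤ_p`, `σ` fixing `μ_{p^∞}`: a transvection mod `p`) and Fouquet–Wan's Steinberg
  hypothesis (`ℓ ∥ N` with `dim ρ̄^{I_ℓ} = 1`: inertia through a transvection) never apply to a row of 19606 — its
  `pⁿ`-slack (Kobayashi Thm. 4.1) is structural, not an artefact of the cell's bookkeeping.
* §5 row-level wrapper from the crux's own hypotheses (`5 ≤ p`, good, `a_p = 0`, tower not onto).

HONEST FRAMING (cell `bsd-potss`, run/shared/lean/pub/bsd-potss/; FULL-BSD rank ≤ 1 programme): TOOL THEOREMS ONLY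
(no definition, no named fact, no `sorry`, axioms standard). Nothing is booked; crux 19606 stays OPEN; `BSD(W, p)` is
claimed for no pair. Seat `bsd-potss-k8eta-c2` g9 (prover), `--supports stmt-BirchSwinnertonDyer-19606`.

References: [Serre1972] §2.2, §4.5; [Kato2004Asterisque] Thm. 13.4 (3) (p. 226); O. Fouquet, X. Wan, arXiv:2107.13726,
Thm. 1.1 (third hypothesis); [Zywina2015] Thm. 1.4; S. Frengley, arXiv:2111.05813, Lemma 28.
-/

set_option autoImplicit false
set_option linter.dupNamespace false

noncomputable section

open scoped Classical

open Matrix Field WeierstrassCurve Literature.NumberTheory.EllipticCurves Literature.NumberTheory.SerreUniformity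
  Literature.NumberTheory.EllipticCurves.Rank1Residual
open Summit.BirchSwinnertonDyer.Rank1Residual.O6 (ModPCongruent)

namespace Summit.BirchSwinnertonDyer.BirchSwinnertonDyer.Theorems.EtaCartanField

variable {p : ℕ} [hp : Fact p.Prime]

/-! ## §1 Frames: matrices of Galois elements in a basis of `V[p]` -/

section Frame

variable {V : WeierstrassCurve ℚ} (e : V.geomTorsion p ≃+ (Fin 2 → ZMod p))

/-- The matrix of a product is the product of the matrices. [folklore] -/
theorem matrix_mul {σ τ : absoluteGaloisGroup ℚ} {M N : Matrix (Fin 2) (Fin 2) (ZMod p)}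
    (hσ : ∀ P : V.geomTorsion p, e (σ • P) = M.mulVec (e P))
    (hτ : ∀ P : V.geomTorsion p, e (τ • P) = N.mulVec (e P)) :
    ∀ P : V.geomTorsion p, e ((σ * τ) • P) = (M * N).mulVec (e P) := by
  intro P
  rw [mul_smul, hσ, hτ, Matrix.mulVec_mulVec]

/-- The matrix of `σ` in the frame `e` is unique. [folklore] -/
theorem matrix_unique {σ : absoluteGaloisGroup ℚ} {M M' : Matrix (Fin 2) (Fin 2) (ZMod p)}
    (hM : ∀ P : V.geomTorsion p, e (σ • P) = M.mulVec (e P))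
    (hM' : ∀ P : V.geomTorsion p, e (σ • P) = M'.mulVec (e P)) : M = M' := by
  refine Matrix.mulVec_injective (funext fun v => ?_)
  have h1 := hM (e.symm v)
  have h2 := hM' (e.symm v)
  rw [AddEquiv.apply_symm_apply] at h1 h2
  rw [← h1, ← h2]

/-- **Commutation transfer**: `σ` and `τ` commute on `V[p]` iff their matrices commute. [folklore] -/
theorem smul_comm_iff_matrix_comm {σ τ : absoluteGaloisGroup ℚ} {M N : Matrix (Fin 2) (Fin 2) (ZMod p)}
    (hσ : ∀ P : V.geomTorsion p, e (σ • P) = M.mulVec (e P))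
    (hτ : ∀ P : V.geomTorsion p, e (τ • P) = N.mulVec (e P)) :
    (∀ P : V.geomTorsion p, σ • (τ • P) = τ • (σ • P)) ↔ M * N = N * M := by
  constructor
  · intro h
    refine Matrix.mulVec_injective (funext fun v => ?_)
    have h1 : e (σ • (τ • e.symm v)) = (M * N).mulVec v := by
      rw [hσ, hτ, Matrix.mulVec_mulVec, AddEquiv.apply_symm_apply]
    have h2 : e (τ • (σ • e.symm v)) = (N * M).mulVec v := by
      rw [hτ, hσ, Matrix.mulVec_mulVec, AddEquiv.apply_symm_apply]
    rw [← h1, ← h2, h]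
  · intro h P
    apply e.injective
    rw [hσ, hτ, Matrix.mulVec_mulVec, hτ, hσ, Matrix.mulVec_mulVec, h]

end Frame

/-! ## §2 The intrinsic Cartan subgroup: centraliser of the squares -/

section Cartan

variable {V : WeierstrassCurve ℚ}

/-- **`ρ̄(σ) ∈ C_ns(ε)` iff `σ` commutes on `V[p]` with every square `τ²`** (`p ≠ 2`), in any frame `(e, ε)` in which
the image is EXACTLY `C_ns⁺(ε)`. (⟹) every square of `C_ns⁺(ε)` lies in the commutative `C_ns(ε)`; (⟸) an element of the
other coset does not commute with the square `x² = (1 + ε) + 2√ε` of `x = 1 + √ε ∈ C_ns(ε)`, which IS the matrix of some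
`τ²` because the image is all of `C_ns⁺(ε)`. So the predicate "centralises the squares" is a FRAME-FREE description of
the Cartan subgroup `ρ̄⁻¹(C_ns)`. [cite: Serre1972, §2.2] -/
theorem matrix_mem_nonsplitCartan_iff_centralizes_sq (hp2 : p ≠ 2) (e : V.geomTorsion p ≃+ (Fin 2 → ZMod p))
    {ε : ZMod p} (hε : ¬ IsSquare ε)
    (himg : ∀ σ : absoluteGaloisGroup ℚ, ∃ M ∈ nonsplitCartanNormalizer ε,
      ∀ P : V.geomTorsion p, e (σ • P) = M.mulVec (e P))
    (hsurj : ∀ M ∈ nonsplitCartanNormalizer ε, ∃ σ : absoluteGaloisGroup ℚ,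
      ∀ P : V.geomTorsion p, e (σ • P) = M.mulVec (e P))
    {σ : absoluteGaloisGroup ℚ} {M : Matrix (Fin 2) (Fin 2) (ZMod p)} (hM : M ∈ nonsplitCartanNormalizer ε)
    (hσ : ∀ P : V.geomTorsion p, e (σ • P) = M.mulVec (e P)) :
    M ∈ nonsplitCartan ε ↔
      ∀ (τ : absoluteGaloisGroup ℚ) (P : V.geomTorsion p), σ • ((τ * τ) • P) = (τ * τ) • (σ • P) := by
  constructor
  · intro hMC τ
    obtain ⟨T, hT, hτ⟩ := himg τ
    have hττ := matrix_mul e hτ hτ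
    exact (smul_comm_iff_matrix_comm e hσ hττ).mpr
      (mul_comm_of_mem_nonsplitCartan hMC (sq_mem_nonsplitCartan_of_mem_normalizer hε hT))
  · intro hcen
    by_contra hMC
    obtain ⟨τ, hτ⟩ := hsurj _ (nonsplitCartan_subset_normalizer ε (testElement_mem_nonsplitCartan ε))
    have hττ := matrix_mul e hτ hτ
    rw [testElement_sq] at hττ
    have hcomm := (smul_comm_iff_matrix_comm e hσ hττ).mp (hcen τ)
    have h := apply_one_zero_eq_zero_of_commute hp2 hε hM hMC (testElement_sq_mem_nonsplitCartan hp2 ε) hcomm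
    have h2 : (2 : ZMod p) ≠ 0 := Ring.two_ne_zero (by rw [ZMod.ringChar_zmod_n]; exact hp2)
    exact h2 (by simpa using h)

/-- **Some `σ` is NOT in the Cartan subgroup** (the element acting through `diag(1, −1)`, `p ≠ 2`). [cite: Serre1972, §2.2] -/
theorem exists_not_centralizes_sq (hp2 : p ≠ 2) (h : HasModPImageEqNonsplitCartanNormalizer V p) :
    ∃ σ : absoluteGaloisGroup ℚ,
      ¬ ∀ (τ : absoluteGaloisGroup ℚ) (P : V.geomTorsion p), σ • ((τ * τ) • P) = (τ * τ) • (σ • P) := by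
  obtain ⟨e, ε, hε, himg, hsurj⟩ := h
  obtain ⟨σ, hσ⟩ := hsurj _ (diag_mem_nonsplitCartanNormalizer ε)
  refine ⟨σ, fun hcen => diag_not_mem_nonsplitCartan hp2 ε ?_⟩
  exact (matrix_mem_nonsplitCartan_iff_centralizes_sq hp2 e hε himg hsurj
    (diag_mem_nonsplitCartanNormalizer ε) hσ).mpr hcen

/-- **Index `2`**: the product of two elements OUTSIDE the Cartan subgroup lies inside it (`(C_ns⁺ : C_ns) = 2`).
[cite: Serre1972, §2.2] -/
theorem centralizes_sq_mul_of_not_of_not (hp2 : p ≠ 2) (h : HasModPImageEqNonsplitCartanNormalizer V p)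
    {σ τ : absoluteGaloisGroup ℚ}
    (hσ : ¬ ∀ (ν : absoluteGaloisGroup ℚ) (P : V.geomTorsion p), σ • ((ν * ν) • P) = (ν * ν) • (σ • P))
    (hτ : ¬ ∀ (ν : absoluteGaloisGroup ℚ) (P : V.geomTorsion p), τ • ((ν * ν) • P) = (ν * ν) • (τ • P)) :
    ∀ (ν : absoluteGaloisGroup ℚ) (P : V.geomTorsion p), (σ * τ) • ((ν * ν) • P) = (ν * ν) • ((σ * τ) • P) := by
  obtain ⟨e, ε, hε, himg, hsurj⟩ := h
  obtain ⟨M, hM, hMσ⟩ := himg σ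
  obtain ⟨N, hN, hNτ⟩ := himg τ
  have hMC : M ∉ nonsplitCartan ε := fun hMC =>
    hσ ((matrix_mem_nonsplitCartan_iff_centralizes_sq hp2 e hε himg hsurj hM hMσ).mp hMC)
  have hNC : N ∉ nonsplitCartan ε := fun hNC =>
    hτ ((matrix_mem_nonsplitCartan_iff_centralizes_sq hp2 e hε himg hsurj hN hNτ).mp hNC)
  have hMN : M * N ∈ nonsplitCartan ε := mul_mem_nonsplitCartan_of_not_mem_of_not_mem hε hM hMC hN hNC
  exact (matrix_mem_nonsplitCartan_iff_centralizes_sq hp2 e hε himg hsurj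
    (nonsplitCartan_subset_normalizer ε hMN) (matrix_mul e hMσ hNτ)).mp hMN

/-- **The Cartan subgroup.** On a row of the crux (`Im ρ̄_{V,p} = C_ns⁺(p)`, `p ≠ 2`) there is a subgroup `H_V ≤ Γ_ℚ` of
INDEX `2` whose elements are exactly the `σ` centralising the squares on `V[p]` — i.e. `H_V = ρ̄⁻¹(C_ns(p))`, the absolute
Galois group of the Cartan field `K_V` (an ∃-statement: no new definition is introduced). [cite: Serre1972, §2.2]
[cite: Zywina2015, Thm. 1.4 (the family `X_ns⁺(5)`)] -/
theorem exists_subgroup_index_two_centralizes_sq (hp2 : p ≠ 2) (h : HasModPImageEqNonsplitCartanNormalizer V p) :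
    ∃ H : Subgroup (absoluteGaloisGroup ℚ), H.index = 2 ∧
      ∀ σ : absoluteGaloisGroup ℚ, σ ∈ H ↔
        ∀ (τ : absoluteGaloisGroup ℚ) (P : V.geomTorsion p), σ • ((τ * τ) • P) = (τ * τ) • (σ • P) := by
  let H : Subgroup (absoluteGaloisGroup ℚ) :=
    { carrier := {σ | ∀ (τ : absoluteGaloisGroup ℚ) (P : V.geomTorsion p),
        σ • ((τ * τ) • P) = (τ * τ) • (σ • P)}
      one_mem' := by
        intro τ P
        rw [one_smul, one_smul]
      mul_mem' := by
        intro σ σ' hσ hσ' τ P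
        rw [mul_smul σ σ' ((τ * τ) • P), hσ' τ P, hσ τ (σ' • P), mul_smul σ σ' P]
      inv_mem' := by
        intro σ hσ τ P
        have h1 := hσ τ (σ⁻¹ • P)
        rw [smul_inv_smul] at h1
        calc σ⁻¹ • ((τ * τ) • P) = σ⁻¹ • (σ • ((τ * τ) • (σ⁻¹ • P))) := by rw [h1]
          _ = (τ * τ) • (σ⁻¹ • P) := inv_smul_smul σ _ }
  have hmem : ∀ σ : absoluteGaloisGroup ℚ, σ ∈ H ↔
      ∀ (τ : absoluteGaloisGroup ℚ) (P : V.geomTorsion p), σ • ((τ * τ) • P) = (τ * τ) • (σ • P) :=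
    fun σ => Iff.rfl
  refine ⟨H, ?_, hmem⟩
  obtain ⟨σ₀, hσ₀⟩ := exists_not_centralizes_sq hp2 h
  rw [Subgroup.index_eq_two_iff]
  refine ⟨σ₀, fun b => ?_⟩
  by_cases hb : b ∈ H
  · refine Or.inr ⟨hb, fun hba => hσ₀ ?_⟩
    have : σ₀ = b⁻¹ * (b * σ₀) := by group
    rw [← hmem, this]
    exact H.mul_mem (H.inv_mem hb) hba
  · exact Or.inl ⟨(hmem _).mpr (centralizes_sq_mul_of_not_of_not hp2 h ((hmem b).not.mp hb) hσ₀), hb⟩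

end Cartan

/-! ## §3 Congruence invariance -/

omit hp in
/-- **The Cartan subgroup is an invariant of the mod-`p` Galois module**: a `Γ_ℚ`-equivariant `V[p] ≅ A[p]`
(`ModPCongruent V A p`) transports "centralises the squares" verbatim. So congruent rows have the same Cartan field —
a CM anchor `A` of `V` must have `K_A = K_V` (§5). [folklore] -/
theorem centralizes_sq_iff_of_modPCongruent {V A : WeierstrassCurve ℚ} (hVA : ModPCongruent V A p)
    (σ : absoluteGaloisGroup ℚ) :
    (∀ (τ : absoluteGaloisGroup ℚ) (P : V.geomTorsion p), σ • ((τ * τ) • P) = (τ * τ) • (σ • P)) ↔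
      ∀ (τ : absoluteGaloisGroup ℚ) (Q : A.geomTorsion p), σ • ((τ * τ) • Q) = (τ * τ) • (σ • Q) := by
  obtain ⟨f, hf⟩ := hVA
  constructor
  · intro h τ Q
    have h1 := congrArg f (h τ (f.symm Q))
    rw [hf, hf, hf, hf, AddEquiv.apply_symm_apply] at h1
    exact h1
  · intro h τ P
    apply f.injective
    rw [hf, hf, hf, hf]
    exact h τ (f P)

/-! ## §4 No transvection acts on `V[p]` -/

/-- **No transvection.** On a row (`Im ρ̄_{V,p} ⊆ C_ns⁺(ε)`, `p ≠ 2`), a `σ ∈ Γ_ℚ` with `(σ − 1)² = 0` on `V[p]` — written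
additively `σσP + P = σP + σP` — acts TRIVIALLY on `V[p]` (`C_ns⁺` has no element of order `p`). Hence on the rows of
crux 19606 the two in-print INTEGRAL Euler-system handles are idle: Kato's Thm. 13.4 (3) needs `σ` fixing `μ_{p^∞}` with
`T_pV/(σ − 1) ≅ ℤ_p` (so `σ` is a non-trivial transvection mod `p`), and Fouquet–Wan's Thm. 1.1 needs a multiplicative
prime `ℓ ∥ N` at which `ρ̄` is RAMIFIED (`dim ρ̄^{I_ℓ} = 1`: inertia acts through a transvection) — both impossible here;
the `pⁿ` of Kobayashi's Thm. 4.1 cannot be removed by either on these rows. [cite: Kato2004Asterisque, Thm. 13.4 (3) (p. 226)]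
[cite: Serre1972, §2.2] -/
theorem smul_eq_self_of_transvection (hp2 : p ≠ 2) {V : WeierstrassCurve ℚ} (h : HasNonsplitCartanModPImage V p)
    {σ : absoluteGaloisGroup ℚ}
    (hσ : ∀ P : V.geomTorsion p, σ • (σ • P) + P = σ • P + σ • P) : ∀ P : V.geomTorsion p, σ • P = P := by
  obtain ⟨e, ε, hε, himg⟩ := h
  obtain ⟨M, hM, hMσ⟩ := himg σ
  have hU : (M - 1) * (M - 1) = 0 := by
    refine Matrix.mulVec_injective (funext fun v => ?_)
    have h1 := congrArg e (hσ (e.symm v))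
    rw [map_add, map_add, hMσ, hMσ, AddEquiv.apply_symm_apply, Matrix.mulVec_mulVec] at h1
    have hexp : (M - 1) * (M - 1) = M * M - M - M + 1 := by noncomm_ring
    have h2 : (M * M).mulVec v - M.mulVec v - M.mulVec v + v =
        ((M * M).mulVec v + v) - (M.mulVec v + M.mulVec v) := by abel
    rw [hexp, Matrix.zero_mulVec, Matrix.add_mulVec, Matrix.sub_mulVec, Matrix.sub_mulVec, Matrix.one_mulVec, h2,
      h1, sub_self]
  have hM1 := eq_one_of_unipotent_of_mem_nonsplitCartanNormalizer hp2 hε hM hU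
  intro P
  apply e.injective
  rw [hMσ, hM1, Matrix.one_mulVec]

/-! ## §5 Row-level wrappers (hypotheses of the crux; route-free) -/

/-- **The rows of crux 19606 have image exactly `C_ns⁺(p)`** (route-free re-derivation of p448914
`not_forall_surj_pow_iff_cartanNormalizer`, ⟹ direction): at `p ≥ 5` good with `a_p = 0`, a `p`-adic tower that is
not onto is not onto mod `p` (Serre's lifting lemma, tree theorem `serre_hasSurjectiveModNGaloisRep_pow_holds`), and then
the exact-image theorem at a good supersingular prime applies (`hasModPImageEqNonsplitCartanNormalizer_of_goodSS_of_not_surj`).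
[cite: Serre1972, §1.11 Prop. 12, §2.7 Prop. 17] [cite: SerreAbelianLadic1968, Ch. IV §3.4 Lemma 3 (IV-23)] -/
theorem hasModPImageEqNonsplitCartanNormalizer_of_row (V : WeierstrassCurve ℚ) [V.IsElliptic] [V.IsGloballyMinimal]
    (p : ℕ) [Fact p.Prime] (hp5 : 5 ≤ p) (hgood : V.HasGoodReductionAtPrime p) (hap : V.frobeniusTrace p = 0)
    (hns : ¬ ∀ m : ℕ, V.HasSurjectiveModNGaloisRep (p ^ m : ℕ)) : HasModPImageEqNonsplitCartanNormalizer V p := by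
  have hp2 : p ≠ 2 := by omega
  have hss : GoodSS V p := ⟨hgood, by rw [hap]; exact dvd_zero _⟩
  have hns' : ¬ Surj V p := fun h => hns (serre_hasSurjectiveModNGaloisRep_pow_holds V p hp5 h)
  exact Rank1Residual.GaloisImage.hasModPImageEqNonsplitCartanNormalizer_of_goodSS_of_not_surj V p hp2 hss hns'

/-- **On every row of crux 19606** (`V/ℚ` globally minimal, `p ≥ 5` good with `a_p = 0`, `p`-adic tower NOT onto) the
Cartan subgroup exists: an index-`2` subgroup `H_V ≤ Γ_ℚ` with `σ ∈ H_V ⟺ σ` centralises the squares on `V[p]`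
(`= ρ̄⁻¹(C_ns(p))`; fixed field = the Cartan field `K_V`). [cite: Serre1972, §2.2] [cite: Zywina2015, Thm. 1.4] -/
theorem exists_cartanSubgroup_of_row (V : WeierstrassCurve ℚ) [V.IsElliptic] [V.IsGloballyMinimal] (p : ℕ)
    [Fact p.Prime] (hp5 : 5 ≤ p) (hgood : V.HasGoodReductionAtPrime p) (hap : V.frobeniusTrace p = 0)
    (hns : ¬ ∀ m : ℕ, V.HasSurjectiveModNGaloisRep (p ^ m : ℕ)) :
    ∃ H : Subgroup (absoluteGaloisGroup ℚ), H.index = 2 ∧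
      ∀ σ : absoluteGaloisGroup ℚ, σ ∈ H ↔
        ∀ (τ : absoluteGaloisGroup ℚ) (P : V.geomTorsion p), σ • ((τ * τ) • P) = (τ * τ) • (σ • P) :=
  exists_subgroup_index_two_centralizes_sq (by omega)
    (hasModPImageEqNonsplitCartanNormalizer_of_row V p hp5 hgood hap hns)

/-- **No transvection on any row of crux 19606**: a `σ ∈ Γ_ℚ` with `(σ − 1)² = 0` on `V[p]` acts trivially on `V[p]`.
[cite: Kato2004Asterisque, Thm. 13.4 (3) (p. 226)] [cite: Serre1972, §2.2] -/
theorem smul_eq_self_of_transvection_of_row (V : WeierstrassCurve ℚ) [V.IsElliptic] [V.IsGloballyMinimal] (p : ℕ)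
    [Fact p.Prime] (hp5 : 5 ≤ p) (hgood : V.HasGoodReductionAtPrime p) (hap : V.frobeniusTrace p = 0)
    (hns : ¬ ∀ m : ℕ, V.HasSurjectiveModNGaloisRep (p ^ m : ℕ)) {σ : absoluteGaloisGroup ℚ}
    (hσ : ∀ P : V.geomTorsion p, σ • (σ • P) + P = σ • P + σ • P) : ∀ P : V.geomTorsion p, σ • P = P :=
  smul_eq_self_of_transvection (by omega)
    (hasModPImageEqNonsplitCartanNormalizer_of_row V p hp5 hgood hap hns).hasNonsplitCartanModPImage hσ

end Summit.BirchSwinnertonDyer.BirchSwinnertonDyer.Theorems.EtaCartanField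

end
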